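import Literature.AlgebraicGeometry.Motives.HodgeThetaSubalgebraUnitaryTwoOddCore
import Literature.AlgebraicGeometry.Motives.HodgeThetaSubalgebraSymplecticRankSix
import Mathlib.LinearAlgebra.Eigenspace.Triangularizable
import HarnessLib

/-!
# The corners `E𝔏(1−E)` of an irreducible unital Lie algebra of operators `𝔏 ∋ E` with THIN corners:
# no rank-one corner element (orbit lemma), and a thin corner is a line spanned by an isomorphism `ker E ≅ range E`
# (bricks R2–R3 of the `r = 3` leg of the rank-twelve crux; Moonen–Zarhin 1999 (2.3)–(2.5), Gordon §6; classification-free)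

Family `hodge`, layer `Literature/AlgebraicGeometry/Motives` (pure complex linear algebra; no geometry).  Written for the cell
`pub-hodgeav-hg6` (LADDER-HodgeAV row 2, TABLE X row 1 `g6.I(1)`: the `r = 3` return leg of `RankTwelveSimpleCrux34`; eng-2
lineage g5; honest framing of that cell: HC / HC_AV / HC_CM NOT proved — THIS file is unconditional linear algebra).
UNCONDITIONAL; theorems only — no definition, no named fact (D-0026), no `sorry`.

SETTING.  `W` finite-dimensional over `ℂ`; `𝔏 ⊆ End(W)` closed under the commutator, containing `1`, acting irreducibly; an
idempotent `E ∈ 𝔏`.  The UPPER CORNER of `𝔏` at `E` is `{N ∈ 𝔏 : EN = N, NE = 0} ⊆ Hom(ker E, range E)`; it is THIN if every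
corner element of rank `≤ 2` has rank `≤ 1` (this is what the Hodge side supplies for the Levi algebra of a minimal raising
tripotent of rank `3`, brick R1 `WeightOnePeirce.upperCorner_finrank_le_one`).  The elements of `𝔏` commuting with `E` form
the DIAGONAL `D`; `[D, corner] ⊆ corner`.

WHAT IS PROVED.
* §1 `LeviCorner.diag_mem` — for `Z ∈ 𝔏` the diagonal part `EZE + (1−E)Z(1−E)` and the corners `EZ(1−E)`, `(1−E)ZE` lie in `𝔏`.
* §2 **`LeviCorner.false_of_rankOne`** — NO RANK-ONE CORNER ELEMENT when the corner is thin and `dim range E ≥ 2`,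
  `dim ker E ≥ 2`: for `N = u ⊗ φ` (`Eu = u`, `φ ∘ E = 0`) and diagonal `d`, `[d, N] = du ⊗ φ − u ⊗ φd` is a corner element of
  rank `≤ 2`, hence `≤ 1`, so `du ∈ ℂu` or `φd ∈ ℂφ`; a vector space is not a union of two proper subspaces, so either `ℂu ⊆ range E`
  or `ker φ ∩ ker E ⊆ ker E` is stable under the diagonal — contradicting the orbit lemma
  (`SymplecticThetaSix.eq_bot_or_eq_of_stable_le` for `T = ±(2E − 1)`).
* §3 **`LeviCorner.exists_generator`** — if the corner has NO non-zero element of rank `≤ 2` and `dim range E = dim ker E = 3`,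
  then it is a LINE `ℂN₀` with `N₀` injective on `ker E` (non-zero by irreducibility; two independent corner elements `N₁, N₂`
  would give a singular `N₁ − λN₂ ≠ 0` through an eigenvalue of `N₂⁻¹N₁` on `ker E`).
The same statements for the LOWER corner `(1−E)𝔏E` follow by applying them to the idempotent `1 − E`.

## References
* [MoonenZarhin1999LowDim] B. Moonen, Yu. Zarhin, Math. Ann. 315 (1999), §2 (2.3)–(2.5).
* [Gordon1997] B. B. Gordon, *A survey of the Hodge conjecture for abelian varieties*, §6 (proof of Thm. 6.3.3).
* [Humphreys1972] J. E. Humphreys, *Introduction to Lie Algebras and Representation Theory*, §19.1 (rank-one operators).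
* [HoffmanKunze1971LinearAlgebra] K. Hoffman, R. Kunze, *Linear Algebra*, §6.7 (projections), §6.2 (eigenvalues).
-/

noncomputable section

open Module

namespace Literature.AlgebraicGeometry.Motives

namespace HodgeStructure

variable {W : Type*} [AddCommGroup W] [Module ℂ W]

/-! ### §1 Diagonal and corner parts -/

/-- **The corners and the diagonal part of an element of `𝔏` lie in `𝔏`** (`E ∈ 𝔏` idempotent): with `n = EZ(1−E)`,
`m = (1−E)ZE`, `[E, Z] = n − m` and `[E,[E,Z]] = n + m`. [cite: MoonenZarhin1999LowDim, §2 (2.3)] [cite: Humphreys1972, §19.1] -/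
theorem LeviCorner.diag_mem {𝔏 : Submodule ℂ (Module.End ℂ W)} (hbr : ∀ A ∈ 𝔏, ∀ A' ∈ 𝔏, A * A' - A' * A ∈ 𝔏)
    {E : Module.End ℂ W} (hE : E ∈ 𝔏) (hEE : E * E = E) {Z : Module.End ℂ W} (hZ : Z ∈ 𝔏) :
    E * Z * (1 - E) ∈ 𝔏 ∧ (1 - E) * Z * E ∈ 𝔏 ∧ E * Z * E + (1 - E) * Z * (1 - E) ∈ 𝔏 ∧
      (E * Z * E + (1 - E) * Z * (1 - E)) * E = E * (E * Z * E + (1 - E) * Z * (1 - E)) := by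
  have h1 : E * Z - Z * E ∈ 𝔏 := hbr E hE Z hZ
  have h2 : E * (E * Z - Z * E) - (E * Z - Z * E) * E ∈ 𝔏 := hbr E hE _ h1
  have e1 : E * Z - Z * E = E * Z * (1 - E) - (1 - E) * Z * E := by
    simp only [mul_sub, mul_one, sub_mul, one_mul, mul_assoc]; abel
  have e2 : E * (E * Z - Z * E) - (E * Z - Z * E) * E = E * Z * (1 - E) + (1 - E) * Z * E := by
    rw [mul_sub, sub_mul, ← mul_assoc, hEE, mul_assoc Z E E, hEE]
    simp only [mul_sub, mul_one, sub_mul, one_mul, mul_assoc]; abel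
  rw [e1] at h1
  rw [e2] at h2
  have hn : E * Z * (1 - E) ∈ 𝔏 := by
    have h := 𝔏.add_mem h1 h2
    rw [sub_add_add_cancel, ← two_smul ℂ] at h
    exact (Submodule.smul_mem_iff _ two_ne_zero).1 h
  have hm : (1 - E) * Z * E ∈ 𝔏 := by
    have h := 𝔏.sub_mem h2 h1
    rw [add_sub_sub_cancel, ← two_smul ℂ] at h
    exact (Submodule.smul_mem_iff _ two_ne_zero).1 h
  refine ⟨hn, hm, ?_, ?_⟩
  · have e3 : E * Z * E + (1 - E) * Z * (1 - E) = Z - E * Z * (1 - E) - (1 - E) * Z * E := by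
      simp only [mul_sub, mul_one, sub_mul, one_mul, mul_assoc]; abel
    rw [e3]
    exact 𝔏.sub_mem (𝔏.sub_mem hZ hn) hm
  · have hEEl : ∀ X : Module.End ℂ W, E * (E * X) = E * X := fun X => by rw [← mul_assoc, hEE]
    simp only [mul_sub, mul_one, sub_mul, one_mul, add_mul, mul_add, mul_assoc, hEE, hEEl]
    abel

/-! ### §2 No rank-one corner element -/

section RankOne

variable [FiniteDimensional ℂ W]

set_option maxHeartbeats 3200000 in
/-- **No rank-one element in a thin corner.**  `𝔏 ⊆ End(W)` bracket-closed, `1 ∈ 𝔏`, irreducible; `E ∈ 𝔏` idempotent with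
`dim range E ≥ 2`, `dim ker E ≥ 2`; every element `N ∈ 𝔏` with `EN = N`, `NE = 0` and rank `≤ 2` has rank `≤ 1`.  Then there is
no rank-one `u ⊗ φ ∈ 𝔏` with `Eu = u`, `φ ∘ E = 0`. [cite: MoonenZarhin1999LowDim, §2 (2.3)–(2.5)]
[cite: Gordon1997, §6 (proof of Thm. 6.3.3)] [cite: Humphreys1972, §19.1] -/
theorem LeviCorner.false_of_rankOne {𝔏 : Submodule ℂ (Module.End ℂ W)}
    (hbr : ∀ A ∈ 𝔏, ∀ A' ∈ 𝔏, A * A' - A' * A ∈ 𝔏) (h1 : (1 : Module.End ℂ W) ∈ 𝔏)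
    (hirr : ∀ U : Submodule ℂ W, (∀ A ∈ 𝔏, ∀ u ∈ U, A u ∈ U) → U = ⊥ ∨ U = ⊤)
    {E : Module.End ℂ W} (hE : E ∈ 𝔏) (hEE : E * E = E)
    (hEr : 2 ≤ finrank ℂ (LinearMap.range E)) (hEk : 2 ≤ finrank ℂ (LinearMap.ker E))
    (hthin : ∀ N ∈ 𝔏, E * N = N → N * E = 0 → finrank ℂ (LinearMap.range N) ≤ 2 →
      finrank ℂ (LinearMap.range N) ≤ 1)
    {u : W} {φ : Module.Dual ℂ W} (hu : u ≠ 0) (hφ : φ ≠ 0) (hN : φ.smulRight u ∈ 𝔏) (hEu : E u = u)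
    (hφE : φ ∘ₗ E = 0) : False := by
  classical
  have hEEv : ∀ w, E (E w) = E w := fun w => by rw [← Module.End.mul_apply, hEE]
  have hφEv : ∀ w, φ (E w) = 0 := fun w => by
    have h := congrArg (fun f : Module.Dual ℂ W => f w) hφE
    simpa using h
  -- the involution `T = 2E − 1` and its eigenspaces
  set T : Module.End ℂ W := (2 : ℂ) • E - 1 with hTdef
  have hTv : ∀ w, T w = (2 : ℂ) • E w - w := fun w => by
    rw [hTdef, LinearMap.sub_apply, LinearMap.smul_apply, Module.End.one_apply]
  have hT𝔏 : T ∈ 𝔏 := 𝔏.sub_mem (𝔏.smul_mem _ hE) h1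
  have hnT𝔏 : -T ∈ 𝔏 := 𝔏.neg_mem hT𝔏
  have hTT : ∀ w, T (T w) = w := fun w => by
    rw [hTv, hTv, map_sub, map_smul, hEEv, smul_sub]
    module
  have hnTT : ∀ w, (-T) ((-T) w) = w := fun w => by rw [LinearMap.neg_apply, LinearMap.neg_apply, map_neg, neg_neg, hTT]
  have hPT : ∀ x ∈ LinearMap.range E, T x = x := by
    rintro _ ⟨w, rfl⟩
    rw [hTv, hEEv, two_smul]; abel
  have hQT : ∀ x ∈ LinearMap.ker E, T x = -x := fun x hx => by
    rw [hTv, LinearMap.mem_ker.1 hx, smul_zero, zero_sub]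
  have hPmem : ∀ w, (2 : ℂ)⁻¹ • (w + T w) ∈ LinearMap.range E := fun w =>
    ⟨w, by rw [hTv]; module⟩
  have hQmem : ∀ w, (2 : ℂ)⁻¹ • (w - T w) ∈ LinearMap.ker E := fun w => by
    rw [LinearMap.mem_ker, hTv, map_smul, map_sub, map_sub, map_smul, hEEv]
    module
  have hPnT : ∀ x ∈ LinearMap.ker E, (-T) x = x := fun x hx => by rw [LinearMap.neg_apply, hQT x hx, neg_neg]
  have hQnT : ∀ x ∈ LinearMap.range E, (-T) x = -x := fun x hx => by rw [LinearMap.neg_apply, hPT x hx]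
  have hPnmem : ∀ w, (2 : ℂ)⁻¹ • (w + (-T) w) ∈ LinearMap.ker E := fun w => by
    rw [LinearMap.neg_apply, ← sub_eq_add_neg]; exact hQmem w
  have hQnmem : ∀ w, (2 : ℂ)⁻¹ • (w - (-T) w) ∈ LinearMap.range E := fun w => by
    rw [LinearMap.neg_apply, sub_neg_eq_add]; exact hPmem w
  -- diagonal parts
  have hdiag : ∀ Z ∈ 𝔏, ∃ d ∈ 𝔏, d * E = E * d ∧ (∀ x ∈ LinearMap.range E, E (Z x) = Z x → d x = Z x) ∧
      (∀ x ∈ LinearMap.ker E, E (Z x) = 0 → d x = Z x) := by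
    intro Z hZ
    obtain ⟨-, -, hd, hdE⟩ := LeviCorner.diag_mem hbr hE hEE hZ
    refine ⟨_, hd, hdE, ?_, ?_⟩
    · rintro _ ⟨w, rfl⟩ hZx
      simp only [LinearMap.add_apply, Module.End.mul_apply, LinearMap.sub_apply, Module.End.one_apply, hEEv, sub_self,
        map_zero, add_zero, hZx]
    · intro x hx hZx
      have hx' : E x = 0 := LinearMap.mem_ker.1 hx
      simp only [LinearMap.add_apply, Module.End.mul_apply, LinearMap.sub_apply, Module.End.one_apply, hx', map_zero,
        zero_add, sub_zero, hZx]
  -- the dichotomy for a diagonal element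
  have hdich : ∀ d ∈ 𝔏, d * E = E * d → d u ∈ (ℂ ∙ u) ∨ ∃ c : ℂ, φ ∘ₗ d = c • φ := by
    intro d hd hdE
    set X : Module.End ℂ W := d * φ.smulRight u - φ.smulRight u * d with hXdef
    have hX : X ∈ 𝔏 := hbr d hd _ hN
    have hXv : ∀ w, X w = φ w • d u - φ (d w) • u := fun w => by
      simp only [hXdef, LinearMap.sub_apply, Module.End.mul_apply, LinearMap.smulRight_apply, map_smul]
    have hEX : E * X = X := by
      refine LinearMap.ext fun w => ?_
      rw [Module.End.mul_apply, hXv, map_sub, map_smul, map_smul, hEu, ← Module.End.mul_apply E d u, ← hdE,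
        Module.End.mul_apply, hEu]
    have hXE : X * E = 0 := by
      refine LinearMap.ext fun w => ?_
      rw [Module.End.mul_apply, hXv, hφEv, zero_smul, zero_sub, ← Module.End.mul_apply, hdE, Module.End.mul_apply, hφEv,
        zero_smul, neg_zero, LinearMap.zero_apply]
    have hXle : LinearMap.range X ≤ (ℂ ∙ d u) ⊔ (ℂ ∙ u) := by
      rintro _ ⟨w, rfl⟩
      rw [hXv]
      exact Submodule.sub_mem _ (Submodule.mem_sup_left (Submodule.smul_mem _ _ (Submodule.mem_span_singleton_self _)))
        (Submodule.mem_sup_right (Submodule.smul_mem _ _ (Submodule.mem_span_singleton_self _)))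
    have hX2 : finrank ℂ (LinearMap.range X) ≤ 2 := by
      refine (Submodule.finrank_mono hXle).trans ((Submodule.finrank_add_le_finrank_add_finrank _ _).trans ?_)
      have h1' := finrank_span_le_card (R := ℂ) ({d u} : Set W)
      have h2' := finrank_span_le_card (R := ℂ) ({u} : Set W)
      simp only [Set.toFinset_singleton, Finset.card_singleton] at h1' h2'
      omega
    have hX1 : finrank ℂ (LinearMap.range X) ≤ 1 := hthin X hX hEX hXE hX2
    by_cases hdu : d u ∈ (ℂ ∙ u)
    · exact Or.inl hdu
    · right
      obtain ⟨w₀, hw₀⟩ : ∃ w₀, φ w₀ = 1 := by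
        obtain ⟨w, hw⟩ : ∃ w, φ w ≠ 0 := by
          by_contra h
          push Not at h
          exact hφ (LinearMap.ext h)
        exact ⟨(φ w)⁻¹ • w, by rw [map_smul, smul_eq_mul, inv_mul_cancel₀ hw]⟩
      set c := φ (d w₀) with hc
      refine ⟨c, LinearMap.ext fun w => ?_⟩
      have hx₀ : X w₀ ≠ 0 := by
        intro h0
        rw [hXv, hw₀, one_smul, sub_eq_zero] at h0
        exact hdu (by rw [h0]; exact Submodule.smul_mem _ _ (Submodule.mem_span_singleton_self _))
      have hmem : X w ∈ (ℂ ∙ X w₀) :=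
        UnitaryTwoOdd.mem_span_of_finrank_le_one hX1 (LinearMap.mem_range_self X w₀) (LinearMap.mem_range_self X w) hx₀
      obtain ⟨l, hl⟩ := Submodule.mem_span_singleton.1 hmem
      rw [hXv, hXv, hw₀, one_smul, smul_sub, smul_smul] at hl
      -- `(φ w − l) • d u + (l c − φ (d w)) • u = 0`
      have hrel : (φ w - l) • d u = (φ (d w) - l * c) • u := by
        rw [sub_smul, sub_smul]
        exact sub_eq_sub_iff_sub_eq_sub.1 hl.symm
      have hφw : φ w = l := by
        by_contra hne
        apply hdu
        have h := congrArg (fun v => (φ w - l)⁻¹ • v) hrel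
        simp only [smul_smul, inv_mul_cancel₀ (sub_ne_zero.2 hne), one_smul] at h
        rw [h]
        exact Submodule.smul_mem _ _ (Submodule.mem_span_singleton_self _)
      rw [hφw, sub_self, zero_smul, eq_comm, smul_eq_zero] at hrel
      rcases hrel with h | h
      · rw [LinearMap.comp_apply, LinearMap.smul_apply, smul_eq_mul, hφw]
        linear_combination h
      · exact absurd h hu
  -- a vector space is not the union of two proper subspaces
  have hcases : (∀ d ∈ 𝔏, d * E = E * d → d u ∈ (ℂ ∙ u)) ∨ (∀ d ∈ 𝔏, d * E = E * d → ∃ c : ℂ, φ ∘ₗ d = c • φ) := by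
    by_cases hA : ∀ d ∈ 𝔏, d * E = E * d → d u ∈ (ℂ ∙ u)
    · exact Or.inl hA
    · right
      intro d₂ hd₂ hd₂E
      obtain ⟨d₁, hd₁⟩ := not_forall.1 hA
      obtain ⟨hd₁𝔏, hd₁'⟩ := Classical.not_imp.1 hd₁
      obtain ⟨hd₁E, hd₁u⟩ := Classical.not_imp.1 hd₁'
      obtain ⟨c₁, hc₁⟩ := (hdich d₁ hd₁𝔏 hd₁E).resolve_left hd₁u
      rcases hdich d₂ hd₂ hd₂E with hd₂u | hB₂
      · have h12 : d₁ + d₂ ∈ 𝔏 := 𝔏.add_mem hd₁𝔏 hd₂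
        have h12E : (d₁ + d₂) * E = E * (d₁ + d₂) := by rw [add_mul, mul_add, hd₁E, hd₂E]
        rcases hdich _ h12 h12E with h | ⟨c, hc⟩
        · exfalso
          apply hd₁u
          have e : d₁ u = (d₁ + d₂) u - d₂ u := by rw [LinearMap.add_apply, add_sub_cancel_right]
          rw [e]
          exact Submodule.sub_mem _ h hd₂u
        · refine ⟨c - c₁, ?_⟩
          have e : φ ∘ₗ d₂ = φ ∘ₗ (d₁ + d₂) - φ ∘ₗ d₁ := by rw [LinearMap.comp_add, add_sub_cancel_left]
          rw [e, hc, hc₁, sub_smul]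
      · exact hB₂
  rcases hcases with hA | hB
  · -- the line `ℂu ⊆ range E` is stable under the Levi part: orbit lemma for `T = 2E − 1`
    have hst := SymplecticThetaSix.eq_bot_or_eq_of_stable_le 𝔏 hbr hT𝔏 hTT hPT hQT hPmem hQmem hirr (ℂ ∙ u)
      ((Submodule.span_singleton_le_iff_mem _ _).2 ⟨u, hEu⟩) fun Z hZ hZP x hx => by
        obtain ⟨a, rfl⟩ := Submodule.mem_span_singleton.1 hx
        rw [map_smul]
        refine Submodule.smul_mem _ _ ?_
        obtain ⟨d, hd, hdE, hdP, -⟩ := hdiag Z hZ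
        have hZu : Z u ∈ LinearMap.range E := hZP u ⟨u, hEu⟩
        have hEZu : E (Z u) = Z u := by obtain ⟨w, hw⟩ := hZu; rw [← hw, hEEv]
        rw [← hdP u ⟨u, hEu⟩ hEZu]
        exact hA d hd hdE
    rcases hst with h | h
    · exact hu ((Submodule.span_singleton_eq_bot).1 h)
    · have hfin := finrank_span_singleton (K := ℂ) hu
      rw [h] at hfin
      omega
  · -- `ker φ ∩ ker E ⊆ ker E` is stable under the Levi part: orbit lemma for `T = 1 − 2E`
    set U₁ : Submodule ℂ W := LinearMap.ker φ ⊓ LinearMap.ker E with hU₁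
    have hst := SymplecticThetaSix.eq_bot_or_eq_of_stable_le 𝔏 hbr hnT𝔏 hnTT hPnT hQnT hPnmem hQnmem hirr U₁
      inf_le_right fun Z hZ hZP x hx => by
        obtain ⟨hxφ, hxE⟩ := Submodule.mem_inf.1 hx
        have hZx : Z x ∈ LinearMap.ker E := hZP x hxE
        refine Submodule.mem_inf.2 ⟨?_, hZx⟩
        obtain ⟨d, hd, hdE, -, hdQ⟩ := hdiag Z hZ
        obtain ⟨c, hc⟩ := hB d hd hdE
        rw [LinearMap.mem_ker, ← hdQ x hxE (LinearMap.mem_ker.1 hZx)]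
        have h := congrArg (fun f : Module.Dual ℂ W => f x) hc
        simp only [LinearMap.comp_apply, LinearMap.smul_apply, smul_eq_mul] at h
        rw [h, LinearMap.mem_ker.1 hxφ, mul_zero]
    rcases hst with h | h
    · -- `U₁ = ⊥` contradicts `dim ker E ≥ 2`
      have hpos : 0 < finrank ℂ (LinearMap.ker E) := by omega
      obtain ⟨⟨k₁, hk₁⟩, hk₁0⟩ := Module.finrank_pos_iff_exists_ne_zero.1 hpos
      obtain ⟨⟨k₂, hk₂⟩, hind⟩ := exists_linearIndependent_pair_of_one_lt_finrank hEk hk₁0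
      have hk : φ k₂ • k₁ - φ k₁ • k₂ ∈ U₁ := by
        refine Submodule.mem_inf.2 ⟨?_, Submodule.sub_mem _ (Submodule.smul_mem _ _ hk₁) (Submodule.smul_mem _ _ hk₂)⟩
        rw [LinearMap.mem_ker, map_sub, map_smul, map_smul, smul_eq_mul, smul_eq_mul, mul_comm, sub_self]
      rw [h, Submodule.mem_bot] at hk
      have hk' : φ k₂ • (⟨k₁, hk₁⟩ : LinearMap.ker E) + (-φ k₁) • (⟨k₂, hk₂⟩ : LinearMap.ker E) = 0 :=
        Subtype.ext (by simpa [sub_eq_add_neg] using hk)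
      obtain ⟨h2, h1⟩ := LinearIndependent.pair_iff.1 hind _ _ hk'
      have hk₁U : k₁ ∈ U₁ := Submodule.mem_inf.2 ⟨LinearMap.mem_ker.2 (neg_eq_zero.1 h1), hk₁⟩
      rw [h, Submodule.mem_bot] at hk₁U
      exact hk₁0 (Subtype.ext hk₁U)
    · -- `U₁ = ker E`: `φ` vanishes on `ker E` and on `range E`, hence `φ = 0`
      apply hφ
      refine LinearMap.ext fun w => ?_
      have hw : w = E w + (w - E w) := by abel
      have hker : w - E w ∈ LinearMap.ker E := by rw [LinearMap.mem_ker, map_sub, hEEv, sub_self]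
      rw [← h] at hker
      rw [hw, map_add, hφEv, zero_add, LinearMap.zero_apply]
      exact LinearMap.mem_ker.1 (Submodule.mem_inf.1 hker).1

end RankOne

/-! ### §3 A thin corner is a line spanned by an isomorphism -/

section Generator

variable [FiniteDimensional ℂ W]

set_option maxHeartbeats 3200000 in
/-- **A thin corner is a line `ℂN₀`, `N₀ : ker E ≅ range E`.**  `𝔏` bracket-closed, irreducible; `E ∈ 𝔏` idempotent with
`dim range E = dim ker E = 3` (hence `range E ≠ 0` and `ker E ≠ W`); no NON-ZERO corner element has rank `≤ 2`.  Then there is a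
corner element `N₀ ≠ 0`, injective on `ker E`, such that every corner element is a multiple of `N₀`.
[cite: MoonenZarhin1999LowDim, §2 (2.5)] [cite: HoffmanKunze1971LinearAlgebra, §6.2] -/
theorem LeviCorner.exists_generator {𝔏 : Submodule ℂ (Module.End ℂ W)}
    (hbr : ∀ A ∈ 𝔏, ∀ A' ∈ 𝔏, A * A' - A' * A ∈ 𝔏)
    (hirr : ∀ U : Submodule ℂ W, (∀ A ∈ 𝔏, ∀ u ∈ U, A u ∈ U) → U = ⊥ ∨ U = ⊤)
    {E : Module.End ℂ W} (hE : E ∈ 𝔏) (hEE : E * E = E)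
    (hEr : finrank ℂ (LinearMap.range E) = 3) (hEk : finrank ℂ (LinearMap.ker E) = 3)
    (hthin : ∀ N ∈ 𝔏, E * N = N → N * E = 0 → finrank ℂ (LinearMap.range N) ≤ 2 → N = 0) :
    ∃ N₀ ∈ 𝔏, E * N₀ = N₀ ∧ N₀ * E = 0 ∧ N₀ ≠ 0 ∧ (∀ x, E x = 0 → N₀ x = 0 → x = 0) ∧
      ∀ N ∈ 𝔏, E * N = N → N * E = 0 → ∃ c : ℂ, N = c • N₀ := by
  classical
  have hEEv : ∀ w, E (E w) = E w := fun w => by rw [← Module.End.mul_apply, hEE]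
  -- a non-zero corner element exists (else `ker E` is `𝔏`-stable)
  obtain ⟨N₀, hN₀, hEN₀, hN₀E, hN₀0⟩ : ∃ N₀ ∈ 𝔏, E * N₀ = N₀ ∧ N₀ * E = 0 ∧ N₀ ≠ 0 := by
    by_contra hno
    push Not at hno
    have hstab : ∀ A ∈ 𝔏, ∀ x ∈ LinearMap.ker E, A x ∈ LinearMap.ker E := by
      intro Z hZ x hx
      obtain ⟨hn, -, -, -⟩ := LeviCorner.diag_mem hbr hE hEE hZ
      have hn0 : E * Z * (1 - E) = 0 := hno _ hn
        (by rw [← mul_assoc, ← mul_assoc, hEE]) (by rw [mul_assoc, sub_mul, one_mul, hEE, sub_self, mul_zero])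
      have hx' : E x = 0 := LinearMap.mem_ker.1 hx
      have h := congrArg (fun F : Module.End ℂ W => F x) hn0
      simp only [Module.End.mul_apply, LinearMap.sub_apply, Module.End.one_apply, hx', sub_zero,
        LinearMap.zero_apply] at h
      exact LinearMap.mem_ker.2 h
    rcases hirr _ hstab with h | h
    · rw [h, finrank_bot] at hEk
      exact absurd hEk (by norm_num)
    · have hE0 : E = 0 := by
        refine LinearMap.ext fun w => ?_
        have hw : w ∈ LinearMap.ker E := h ▸ Submodule.mem_top
        exact LinearMap.mem_ker.1 hw
      rw [hE0, LinearMap.range_zero, finrank_bot] at hEr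
      exact absurd hEr (by norm_num)
  -- rank of a non-zero corner element is `3`: it is injective on `ker E`
  have hinj : ∀ N ∈ 𝔏, E * N = N → N * E = 0 → N ≠ 0 → ∀ x, E x = 0 → N x = 0 → x = 0 := by
    intro N hN hEN hNE hN0 x hEx hNx
    by_contra hx0
    have hrange : LinearMap.range N ≤ LinearMap.range E := by
      rintro _ ⟨w, rfl⟩
      exact ⟨N w, by rw [← Module.End.mul_apply, hEN]⟩
    -- `range N = N(ker E)` and `N` restricted to `ker E` has a kernel, so `rank N ≤ 2`
    have hNv : ∀ w, N w = N (w - E w) := fun w => by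
      rw [map_sub, ← Module.End.mul_apply, hNE, LinearMap.zero_apply, sub_zero]
    let Nr : LinearMap.ker E →ₗ[ℂ] W := N ∘ₗ (LinearMap.ker E).subtype
    have hrangeNr : LinearMap.range N = LinearMap.range Nr := by
      apply le_antisymm
      · rintro _ ⟨w, rfl⟩
        refine ⟨⟨w - E w, by rw [LinearMap.mem_ker, map_sub, hEEv, sub_self]⟩, ?_⟩
        rw [LinearMap.comp_apply, Submodule.subtype_apply, ← hNv]
      · rintro _ ⟨y, rfl⟩
        exact ⟨(y : W), rfl⟩
    have hkerNr : LinearMap.ker Nr ≠ ⊥ := by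
      rw [Submodule.ne_bot_iff]
      exact ⟨⟨x, LinearMap.mem_ker.2 hEx⟩, LinearMap.mem_ker.2 hNx, fun h => hx0 (congrArg Subtype.val h)⟩
    have hrk := LinearMap.finrank_range_add_finrank_ker Nr
    rw [hEk] at hrk
    have hk1 : finrank ℂ (LinearMap.ker Nr) ≠ 0 := fun h => hkerNr (Submodule.finrank_eq_zero.1 h)
    have h2 : finrank ℂ (LinearMap.range N) ≤ 2 := by rw [hrangeNr]; omega
    exact hN0 (hthin N hN hEN hNE h2)
  refine ⟨N₀, hN₀, hEN₀, hN₀E, hN₀0, hinj N₀ hN₀ hEN₀ hN₀E hN₀0, fun N hN hEN hNE => ?_⟩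
  -- `N₀` restricted to `ker E` is a bijection onto `range E`
  let K := LinearMap.ker E
  let R := LinearMap.range E
  have hN₀K : ∀ x : K, N₀ (x : W) ∈ R := fun x => ⟨N₀ x, by rw [← Module.End.mul_apply, hEN₀]⟩
  let f₀ : K →ₗ[ℂ] R := (N₀ ∘ₗ K.subtype).codRestrict R hN₀K
  have hf₀inj : Function.Injective f₀ := by
    rw [← LinearMap.ker_eq_bot, Submodule.eq_bot_iff]
    intro x hx
    have h := congrArg Subtype.val (LinearMap.mem_ker.1 hx)
    exact Subtype.ext (hinj N₀ hN₀ hEN₀ hN₀E hN₀0 x (LinearMap.mem_ker.1 x.2) h)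
  have hf₀bij : Function.Bijective f₀ := by
    refine ⟨hf₀inj, ?_⟩
    have hdim : finrank ℂ K = finrank ℂ R := by rw [hEk, hEr]
    exact (LinearMap.injective_iff_surjective_of_finrank_eq_finrank hdim).1 hf₀inj
  let e₀ : K ≃ₗ[ℂ] R := LinearEquiv.ofBijective f₀ hf₀bij
  have he₀ : ∀ x : K, ((e₀ x : R) : W) = N₀ x := fun x => rfl
  have hNK : ∀ x : K, N (x : W) ∈ R := fun x => ⟨N x, by rw [← Module.End.mul_apply, hEN]⟩
  let f : K →ₗ[ℂ] R := (N ∘ₗ K.subtype).codRestrict R hNK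
  let G : Module.End ℂ K := e₀.symm.toLinearMap ∘ₗ f
  -- an eigenvector of `G = N₀⁻¹ N` on `ker E`
  haveI : Nontrivial K := Module.finrank_pos_iff.1 (by rw [hEk]; norm_num)
  obtain ⟨c, hc⟩ := Module.End.exists_eigenvalue G
  obtain ⟨x, hx⟩ := hc.exists_hasEigenvector
  have hGx : G x = c • x := hx.apply_eq_smul
  have hx0 : x ≠ 0 := hx.2
  have hNx : N (x : W) = c • N₀ (x : W) := by
    have h : e₀ (G x) = e₀ (c • x) := by rw [hGx]
    have h' : e₀ (G x) = f x := by
      change e₀ (e₀.symm (f x)) = f x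
      exact e₀.apply_symm_apply (f x)
    rw [h', map_smul] at h
    have h'' := congrArg Subtype.val h
    rw [Submodule.coe_smul, he₀] at h''
    exact h''
  -- `N − c N₀` is a corner element killing `x ≠ 0`, hence `0`
  refine ⟨c, ?_⟩
  have hmem : N - c • N₀ ∈ 𝔏 := 𝔏.sub_mem hN (𝔏.smul_mem _ hN₀)
  have hE' : E * (N - c • N₀) = N - c • N₀ := by rw [mul_sub, mul_smul_comm, hEN, hEN₀]
  have hE'' : (N - c • N₀) * E = 0 := by rw [sub_mul, smul_mul_assoc, hNE, hN₀E, smul_zero, sub_self]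
  by_contra hne
  have hne' : N - c • N₀ ≠ 0 := fun h => hne (sub_eq_zero.1 h)
  have h := hinj _ hmem hE' hE'' hne' (x : W) (LinearMap.mem_ker.1 x.2)
    (by rw [LinearMap.sub_apply, LinearMap.smul_apply, hNx, sub_self])
  exact hx0 (Subtype.ext h)

end Generator

end HodgeStructure

end Literature.AlgebraicGeometry.Motives
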